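import Summits.QuantumAdvantage.QuantumAdvantage.Theses.SpinorFlattening
import Literature.Computability.QuantumComplexity.GaussianRank

/-!
# `FlatteningBoundRobust` (stmt-QuantumAdvantage-1246) — LOAD-BEARING analysis and TIGHTNESS (negative lemmas)

Negative / support lemmas for the crux `SpinorFlattening.FlatteningBoundRobust`
(route QuantumAdvantage/SpinorFlattening, rank 3):

  ∀ t K r, r · D_K(4t) < C(t,K) · 8^K →
    ∀ (a : Fin r → ℂ) (g : Fin r → QReg (4t) → ℂ), (∀ i, IsGaussian (g i)) →
      1 ≤ C(8t,K) · normSq (M^{⊗t} − Σ i, a i • g i),           D_K(N) = Σ_{j ≤ K, j ≡ K (2)} C(N,j),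

extracted from the standing disprover's work file
`Summits/QuantumAdvantage/QuantumAdvantage/Cruxes/FlatteningBoundRobust/Disproof.lean`
(refuter-cdisprove-stmt-QuantumAdvantage-1246-0, cycle 1) so that provers, planners and ideators can
IMPORT them.  Sorry-free; NO definitions (every weakening of the crux is written out in full —
a pure-proof file); nothing here asserts a Theses declaration positively.

* §0 `flatteningBoundRobust_iff_named` — the item's inline `let`-vocabulary IS the named API of
  `GaussianRank.lean` (`majorana`/`IsGaussian`/`magicMPow`/`flatteningDeficiency`), by `Iff.rfl`.
* §1 toolkit — `magicMPow_eq_sum_blockStrings` (the EXACT `2^t`-term Gaussian decomposition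
  `|M⟩^{⊗t} = (√2)^{-t} Σ_{b : Fin t → Bool} |b₀⁴ ⋯ b_{t-1}⁴⟩`, i.e. `χ_G(M^{⊗t}) ≤ 2^t`) and its
  `Fin (2^t)`-indexed form `magicMPow_eq_sum_two_pow`; `normSq_smul_basisState`, `norm_inv_sqrt_two_sq`.
* §A LOAD-BEARING ("any proof must use H"):
  `flatteningBoundRobust_false_without_count` (drop the count `r·D_K(4t) < C(t,K)·8^K`),
  `flatteningBoundRobust_false_with_le` (weaken `<` to `≤`: the STRICT count is sharp at
  (t,K,r) = (1,1,2), where 2·D_1(4) = 8 = C(1,1)·8 and |M⟩ = (|0000⟩+|1111⟩)/√2 is an exact 2-term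
  Gaussian combination), `flatteningBoundRobust_false_without_gauss` (drop `IsGaussian (g i)`),
  `flatteningBoundRobust_false_without_linIndep` (drop `LinearIndependent ℂ A` inside the dictionary:
  `A = 0` makes every `ψ ≠ 0` "Gaussian").
* §B NOT load-bearing: `ψ ≠ 0` inside the dictionary — `flatteningBoundRobust_imp_withoutNonzero`
  (the crux implies its variant over the dictionary `IsGaussian ∪ {0}`; zero terms are dropped).
  CONSEQUENCE the crux forces: `flatteningBoundRobust_imp_count_le_two_pow` — the combinatorial
  inequality `C(t,K)·8^K ≤ 2^t·D_K(4t)` for all `t, K` (a cheap-falsity test; it holds for all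
  `t ≤ 120` by direct evaluation, with equality only at `(0,0)` and `(1,1)`, and asymptotically).
* §C TIGHTNESS / CALIBRATION: the conclusion's constant `1` is attained at (1,0,0)
  (`flatteningBoundRobust_tight_r0`); the mass-bound strengthening
  `1 − r·D_K(4t)/(C(t,K)8^K) ≤ normSq(M^t − φ)` is ATTAINED at (1,1,1) by the half-vacuum witness
  (`massBound_attained_t1`: residual 1/2 = the Gaussian infidelity of |M⟩), hence
  `not_better_than_massBound_t1` and `not_without_binomial_factor_t1`; the rank certificate is sharp
  at t = 1 (`gaussian_decomposition_two_terms_t1`) and off by ≤ 1 at t = 2 (`calibration_t2`: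
  the count admits r ≤ 2 and excludes r = 3, while 4 = 2² terms reach M⊗M; truth ∈ {3,4} is crux
  `GaussRankTwoCopies`).
-/

noncomputable section

set_option linter.dupNamespace false -- D-0017: single-conjunct summit ⇒ `QuantumAdvantage.QuantumAdvantage` by design

namespace Summit.QuantumAdvantage.QuantumAdvantage.Theorems.FlatteningBoundRobust.Negative

open Matrix Finset
open Literature.Computability.QuantumComplexity Literature.Computability.Cryptography
open Summit.QuantumAdvantage.QuantumAdvantage.Theses.SpinorFlattening (FlatteningBoundRobust)

/-! ## §0 The crux over the named API -/

/-- The item's inline `let`-vocabulary is definitionally the named API of `GaussianRank.lean`: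
the crux, restated verbatim over `flatteningDeficiency`, `IsGaussian`, `magicMPow`. [folklore] -/
theorem flatteningBoundRobust_iff_named :
    FlatteningBoundRobust ↔
    ∀ t K r : ℕ, r * flatteningDeficiency K (t * 4) < t.choose K * 8 ^ K →
      ∀ (a : Fin r → ℂ) (g : Fin r → QReg (t * 4) → ℂ), (∀ i, IsGaussian (g i)) →
        (1 : ℝ) ≤ ((t * 8).choose K : ℝ) * normSq (magicMPow t - ∑ i, a i • g i) :=
  Iff.rfl

/-! ## §1 Toolkit: the exact `2^t`-term decomposition, two norm computations -/

/-- EXACT `2^t`-TERM GAUSSIAN DECOMPOSITION (block strings):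
`|M⟩^{⊗t} = (√2)^{-t} Σ_{b : Fin t → Bool} |b₀⁴ b₁⁴ ⋯⟩` — every block-constant basis string is
Gaussian, so `χ_G(M^{⊗t}) ≤ 2^t`. [cite: CudbyStrelchuk2023, §6 (χ_G(|M⟩^{⊗k}) ≤ 2^k)] -/
theorem magicMPow_eq_sum_blockStrings (t : ℕ) :
    magicMPow t = ∑ b : Fin t → Bool, (((Real.sqrt 2 : ℂ)⁻¹) ^ t) •
      basisState (fun w : Fin (t * 4) => b (finProdFinEquiv.symm w).1) := by
  classical
  funext x
  simp only [Finset.sum_apply, Pi.smul_apply, basisState_apply, smul_eq_mul, mul_ite, mul_one,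
    mul_zero]
  by_cases hP : ∀ k : Fin t, ∀ i : Fin 4,
      x (finProdFinEquiv (k, i)) = x (finProdFinEquiv (k, (0 : Fin 4)))
  · rw [magicMPow_apply, if_pos hP]
    rw [Finset.sum_eq_single (fun k => x (finProdFinEquiv (k, (0 : Fin 4))))]
    · rw [if_pos]
      funext w
      obtain ⟨⟨k, i⟩, rfl⟩ := finProdFinEquiv.surjective w
      simp only [Equiv.symm_apply_apply]
      exact hP k i
    · intro b _ hb
      rw [if_neg]
      intro hx
      apply hb
      funext k
      have := congrFun hx (finProdFinEquiv (k, (0 : Fin 4)))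
      simp only [Equiv.symm_apply_apply] at this
      exact this.symm
    · intro h
      exact absurd (Finset.mem_univ _) h
  · rw [magicMPow_apply, if_neg hP]
    symm
    apply Finset.sum_eq_zero
    intro b _
    rw [if_neg]
    intro hx
    apply hP
    intro k i
    rw [hx]
    simp only [Equiv.symm_apply_apply]

/-- The `2^t`-term decomposition in the crux's own shape (indexed by `Fin (2^t)`). [folklore] -/
theorem magicMPow_eq_sum_two_pow (t : ℕ) :
    ∃ (a : Fin (2 ^ t) → ℂ) (g : Fin (2 ^ t) → QReg (t * 4) → ℂ), (∀ i, IsGaussian (g i)) ∧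
      magicMPow t = ∑ i, a i • g i := by
  classical
  have hcard : Fintype.card (Fin t → Bool) = 2 ^ t := by simp
  let e : (Fin t → Bool) ≃ Fin (2 ^ t) := Fintype.equivFinOfCardEq hcard
  refine ⟨fun _ => ((Real.sqrt 2 : ℂ)⁻¹) ^ t,
    fun i => basisState (fun w : Fin (t * 4) => (e.symm i) (finProdFinEquiv.symm w).1),
    fun i => basisState_isGaussian _, ?_⟩
  rw [magicMPow_eq_sum_blockStrings]
  exact (Equiv.sum_comp e.symm (fun b : Fin t → Bool => (((Real.sqrt 2 : ℂ)⁻¹) ^ t) •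
    basisState (fun w : Fin (t * 4) => b (finProdFinEquiv.symm w).1))).symm

/-- `normSq (c • |x⟩) = ‖c‖²`. [folklore] -/
theorem normSq_smul_basisState {n : ℕ} (c : ℂ) (x : QReg n) :
    normSq (c • basisState x) = ‖c‖ ^ 2 := by
  unfold normSq
  rw [Finset.sum_eq_single x]
  · simp [basisState_apply]
  · intro y _ hy
    simp [basisState_apply, hy]
  · simp

/-- `‖(√2)⁻¹‖² = 1/2` in `ℂ`. [folklore] -/
theorem norm_inv_sqrt_two_sq : ‖(Real.sqrt 2 : ℂ)⁻¹‖ ^ 2 = 1 / 2 := by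
  rw [norm_inv, Complex.norm_real, Real.norm_of_nonneg (Real.sqrt_nonneg 2), inv_pow,
    Real.sq_sqrt (by norm_num : (0 : ℝ) ≤ 2)]
  norm_num

/-- The 1-term witness `(√2)⁻¹ |0000⟩` leaves the residual `(√2)⁻¹ |1111⟩`. [folklore] -/
theorem magicMPow_one_sub_half_vacuum :
    magicMPow 1 - (Real.sqrt 2 : ℂ)⁻¹ • (basisState (fun _ => false) : QReg (1 * 4) → ℂ) =
      (Real.sqrt 2 : ℂ)⁻¹ • basisState (fun _ => true) := by
  have h1 : magicMPow 1 = magicM := funext magicMPow_one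
  rw [h1]
  simp only [magicM, smul_add]
  abel

/-! ## §A Load-bearing hypotheses -/

/-- ANY PROOF MUST USE THE COUNT: the crux with `r · D_K(4t) < C(t,K) · 8^K` dropped is false —
at `(t,K,r) = (1,1,2)`, `|M⟩ = (|0000⟩+|1111⟩)/√2` (two Gaussian terms, residual 0) violates
`1 ≤ 8 · 0`. [folklore] -/
theorem flatteningBoundRobust_false_without_count :
    ¬ ∀ t K r : ℕ, ∀ (a : Fin r → ℂ) (g : Fin r → QReg (t * 4) → ℂ), (∀ i, IsGaussian (g i)) →
      (1 : ℝ) ≤ ((t * 8).choose K : ℝ) * normSq (magicMPow t - ∑ i, a i • g i) := by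
  intro h
  obtain ⟨a, g, hg, hdec⟩ := magicMPow_eq_sum_two_pow 1
  have key := h 1 1 (2 ^ 1) a g hg
  rw [← hdec, sub_self] at key
  norm_num [normSq] at key

/-- THE STRICT COUNT IS SHARP: the crux with `<` weakened to `≤` is false — at `(t,K,r) = (1,1,2)`
one has `2 · D_1(4) = 8 = C(1,1) · 8` and the 2-term decomposition of `|M⟩` has residual `0`.
[folklore] -/
theorem flatteningBoundRobust_false_with_le :
    ¬ ∀ t K r : ℕ, r * flatteningDeficiency K (t * 4) ≤ t.choose K * 8 ^ K →
      ∀ (a : Fin r → ℂ) (g : Fin r → QReg (t * 4) → ℂ), (∀ i, IsGaussian (g i)) →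
        (1 : ℝ) ≤ ((t * 8).choose K : ℝ) * normSq (magicMPow t - ∑ i, a i • g i) := by
  intro h
  obtain ⟨a, g, hg, hdec⟩ := magicMPow_eq_sum_two_pow 1
  have hcount : 2 ^ 1 * flatteningDeficiency 1 (1 * 4) ≤ Nat.choose 1 1 * 8 ^ 1 := by decide
  have key := h 1 1 (2 ^ 1) hcount a g hg
  rw [← hdec, sub_self] at key
  norm_num [normSq] at key

/-- ANY PROOF MUST USE GAUSSIANITY: the crux with `IsGaussian (g i)` dropped is false —
`(t,K,r) = (1,1,1)` satisfies the count (`1·4 < 8`) and `g = |M⟩` itself has residual `0`.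
[folklore] -/
theorem flatteningBoundRobust_false_without_gauss :
    ¬ ∀ t K r : ℕ, r * flatteningDeficiency K (t * 4) < t.choose K * 8 ^ K →
      ∀ (a : Fin r → ℂ) (g : Fin r → QReg (t * 4) → ℂ),
        (1 : ℝ) ≤ ((t * 8).choose K : ℝ) * normSq (magicMPow t - ∑ i, a i • g i) := by
  intro h
  have hcount : 1 * flatteningDeficiency 1 (1 * 4) < Nat.choose 1 1 * 8 ^ 1 := by decide
  have key := h 1 1 1 hcount (fun _ => 1) (fun _ => magicMPow 1)
  rw [Fin.sum_univ_one, one_smul, sub_self] at key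
  norm_num [normSq] at key

/-- `|M⟩^{⊗1} ≠ 0` (its squared norm is `1`). [folklore] -/
theorem magicMPow_one_ne_zero : magicMPow 1 ≠ 0 := by
  intro h
  have h1 : magicMPow 1 = magicM := funext magicMPow_one
  have h2 := normSq_magicM
  rw [← h1, h] at h2
  norm_num [normSq] at h2

/-- ANY PROOF MUST USE THE LINEAR INDEPENDENCE of the `n = 4t` annihilators (it is what makes the
annihilator space Lagrangian and the deficiency count `D_K(4t)` valid): over the dictionary
"`ψ ≠ 0` annihilated by `n` arbitrary (possibly zero) Majorana combinations" the crux is false —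
with `A = 0` the state `|M⟩` itself is in the dictionary. [folklore] -/
theorem flatteningBoundRobust_false_without_linIndep :
    ¬ ∀ t K r : ℕ, r * flatteningDeficiency K (t * 4) < t.choose K * 8 ^ K →
      ∀ (a : Fin r → ℂ) (g : Fin r → QReg (t * 4) → ℂ),
        (∀ i, g i ≠ 0 ∧ ∃ A : Fin (t * 4) → (Fin (t * 4) × Bool → ℂ),
          ∀ k, (∑ p : Fin (t * 4) × Bool, A k p • majorana (t * 4) p.1 p.2) *ᵥ g i = 0) →
        (1 : ℝ) ≤ ((t * 8).choose K : ℝ) * normSq (magicMPow t - ∑ i, a i • g i) := by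
  intro h
  have hcount : 1 * flatteningDeficiency 1 (1 * 4) < Nat.choose 1 1 * 8 ^ 1 := by decide
  have key := h 1 1 1 hcount (fun _ => 1) (fun _ => magicMPow 1)
    (fun _ => ⟨magicMPow_one_ne_zero, fun _ _ => 0, fun k => by simp⟩)
  rw [Fin.sum_univ_one, one_smul, sub_self] at key
  norm_num [normSq] at key

/-! ## §B A hypothesis that is NOT load-bearing, and a combinatorial consequence of the crux -/

/-- `ψ ≠ 0` IS NOT LOAD-BEARING: the crux implies its variant over the dictionary with `ψ ≠ 0`
dropped (`IsGaussian ∪ {0}`: `n` linearly independent annihilating combinations, `ψ` possibly `0`) —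
replace every zero term by the vacuum with coefficient `0`; the count hypothesis is untouched.
Prover note: the deficiency bound is trivial for `g = 0`, and for `g ≠ 0` the `n` independent
annihilators are automatically isotropic, hence Lagrangian. [folklore] -/
theorem flatteningBoundRobust_imp_withoutNonzero (h : FlatteningBoundRobust) :
    ∀ t K r : ℕ, r * flatteningDeficiency K (t * 4) < t.choose K * 8 ^ K →
      ∀ (a : Fin r → ℂ) (g : Fin r → QReg (t * 4) → ℂ),
        (∀ i, ∃ A : Fin (t * 4) → (Fin (t * 4) × Bool → ℂ), LinearIndependent ℂ A ∧
          ∀ k, (∑ p : Fin (t * 4) × Bool, A k p • majorana (t * 4) p.1 p.2) *ᵥ g i = 0) →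
        (1 : ℝ) ≤ ((t * 8).choose K : ℝ) * normSq (magicMPow t - ∑ i, a i • g i) := by
  classical
  rw [flatteningBoundRobust_iff_named] at h
  intro t K r hcount a g hg
  let g' : Fin r → QReg (t * 4) → ℂ := fun i => if g i = 0 then zeroState (t * 4) else g i
  let a' : Fin r → ℂ := fun i => if g i = 0 then 0 else a i
  have hg' : ∀ i, IsGaussian (g' i) := by
    intro i
    by_cases hi : g i = 0
    · simp only [g', if_pos hi]
      exact zeroState_isGaussian _
    · simp only [g', if_neg hi]
      exact ⟨hi, hg i⟩
  have hsum : ∑ i, a' i • g' i = ∑ i, a i • g i := by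
    refine Finset.sum_congr rfl fun i _ => ?_
    by_cases hi : g i = 0
    · simp only [a', g', if_pos hi, zero_smul, hi, smul_zero]
    · simp only [a', g', if_neg hi]
  have := h t K r hcount a' g' hg'
  rwa [hsum] at this

/-- UPPER CONSISTENCY (a cheap-falsity test the crux passes): the crux FORCES the purely
combinatorial inequality `C(t,K)·8^K ≤ 2^t · D_K(4t)` for all `t, K` — otherwise the exact
`2^t`-term decomposition would violate `1 ≤ C(8t,K) · 0`.  (Direct evaluation confirms it for all
`t ≤ 120`, with equality only at `(t,K) = (0,0), (1,1)`; asymptotically the exponent gap is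
`1 − max_κ [H(κ) + 3κ − 4H(κ/4)] ≈ 1 − 0.3326`.) [folklore] -/
theorem flatteningBoundRobust_imp_count_le_two_pow (h : FlatteningBoundRobust) (t K : ℕ) :
    t.choose K * 8 ^ K ≤ 2 ^ t * flatteningDeficiency K (t * 4) := by
  by_contra hlt
  rw [not_le] at hlt
  rw [flatteningBoundRobust_iff_named] at h
  obtain ⟨a, g, hg, hdec⟩ := magicMPow_eq_sum_two_pow t
  have key := h t K (2 ^ t) hlt a g hg
  rw [← hdec, sub_self] at key
  norm_num [normSq] at key

/-! ## §C Tightness and calibration -/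

/-- The conclusion's constant `1` IS ATTAINED: at `(t,K,r) = (1,0,0)` (count `0 < 1`),
`C(8,0) · normSq (|M⟩ − 0) = 1`, so no uniform constant `> 1` can replace it. [folklore] -/
theorem flatteningBoundRobust_tight_r0 (a : Fin 0 → ℂ) (g : Fin 0 → QReg (1 * 4) → ℂ) :
    (0 * flatteningDeficiency 0 (1 * 4) < Nat.choose 1 0 * 8 ^ 0) ∧
    ((1 * 8).choose 0 : ℝ) * normSq (magicMPow 1 - ∑ i, a i • g i) = 1 := by
  refine ⟨by decide, ?_⟩
  have h1 : magicMPow 1 = magicM := funext magicMPow_one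
  rw [Finset.univ_eq_empty, Finset.sum_empty, sub_zero, h1, normSq_magicM]
  norm_num

/-- THE MASS-BOUND STRENGTHENING IS ATTAINED at one copy: `g = |0000⟩`, `a = (√2)⁻¹` gives
`normSq (|M⟩ − a g) = 1/2 = 1 − r·D_1(4)/(C(1,1)·8)` with `r = 1` (the Gaussian infidelity of `|M⟩`).
[folklore] -/
theorem massBound_attained_t1 :
    ∃ (a : Fin 1 → ℂ) (g : Fin 1 → QReg (1 * 4) → ℂ), (∀ i, IsGaussian (g i)) ∧
      normSq (magicMPow 1 - ∑ i, a i • g i) = 1 / 2 := by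
  refine ⟨fun _ => (Real.sqrt 2 : ℂ)⁻¹, fun _ => basisState (fun _ => false),
    fun _ => basisState_isGaussian _, ?_⟩
  rw [Fin.sum_univ_one, magicMPow_one_sub_half_vacuum, normSq_smul_basisState,
    norm_inv_sqrt_two_sq]

/-- Hence NO constant better than the mass bound `1 − r·D_K(4t)/(C(t,K)8^K)` (= `1/2` here) holds
at `(t,K,r) = (1,1,1)`: the natural strengthening of the crux is sharp at one copy. [folklore] -/
theorem not_better_than_massBound_t1 :
    ¬ ∃ ε : ℝ, 0 < ε ∧ ∀ (a : Fin 1 → ℂ) (g : Fin 1 → QReg (1 * 4) → ℂ), (∀ i, IsGaussian (g i)) →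
      1 - (1 * (4 : ℝ)) / 8 + ε ≤ normSq (magicMPow 1 - ∑ i, a i • g i) := by
  rintro ⟨ε, hε, h⟩
  obtain ⟨a, g, hg, hval⟩ := massBound_attained_t1
  have := h a g hg
  rw [hval] at this
  linarith

/-- The binomial factor `C(8t,K)` CANNOT BE DROPPED from the conclusion: `1 ≤ normSq (|M⟩ − a g)`
fails for the half-vacuum witness (residual `1/2`). [folklore] -/
theorem not_without_binomial_factor_t1 :
    ¬ ∀ (a : Fin 1 → ℂ) (g : Fin 1 → QReg (1 * 4) → ℂ), (∀ i, IsGaussian (g i)) →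
      (1 : ℝ) ≤ normSq (magicMPow 1 - ∑ i, a i • g i) := by
  intro h
  obtain ⟨a, g, hg, hval⟩ := massBound_attained_t1
  have := h a g hg
  rw [hval] at this
  norm_num at this

/-- THE RANK CERTIFICATE IS SHARP at `t = 1`: the count excludes `r ≤ 1` for `K = 1`
(`1·D_1(4) = 4 < 8`), and `r = 2` Gaussian terms DO reach `|M⟩` exactly (`χ_G(|M⟩) = 2`). [folklore] -/
theorem gaussian_decomposition_two_terms_t1 :
    (1 * flatteningDeficiency 1 (1 * 4) < Nat.choose 1 1 * 8 ^ 1) ∧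
    ∃ (a : Fin 2 → ℂ) (g : Fin 2 → QReg (1 * 4) → ℂ), (∀ i, IsGaussian (g i)) ∧
      magicMPow 1 = ∑ i, a i • g i :=
  ⟨by decide, magicMPow_eq_sum_two_pow 1⟩

/-- CALIBRATION at `t = 2` (two copies): the count admits `r ≤ 2` (`K = 2`: `2·29 < 64`) and no
more (`3·29 ≥ 64`), while `4 = 2^2` Gaussian terms reach `M ⊗ M` exactly; the truth
`χ_G(M⊗M) ∈ {3,4}` is crux `GaussRankTwoCopies` (the Cudby–Strelchuk conjecture `= 4`). [folklore] -/
theorem calibration_t2 :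
    (2 * flatteningDeficiency 2 (2 * 4) < Nat.choose 2 2 * 8 ^ 2) ∧
    ¬ (3 * flatteningDeficiency 2 (2 * 4) < Nat.choose 2 2 * 8 ^ 2) ∧
    ∃ (a : Fin 4 → ℂ) (g : Fin 4 → QReg (2 * 4) → ℂ), (∀ i, IsGaussian (g i)) ∧
      magicMPow 2 = ∑ i, a i • g i :=
  ⟨by decide, by decide, magicMPow_eq_sum_two_pow 2⟩

end Summit.QuantumAdvantage.QuantumAdvantage.Theorems.FlatteningBoundRobust.Negative
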